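import Summits.QuantumFields.YangMills.Theorems.AllWindowsColdBoxBoxHighLineColourDiagContraction
import Summits.QuantumFields.YangMills.Theorems.AllWindowsColdBoxBoxHighLineEdgeTwoCentreSums
import Summits.QuantumFields.YangMills.Theorems.AllWindowsColdBoxBoxHighLineLandauKernelGradDipole
import Summits.QuantumFields.YangMills.Theorems.AllWindowsColdBoxBoxHighLineEdgeChartWick
import Summits.QuantumFields.YangMills.Theorems.AllWindowsColdBoxBoxHighLineTripleBond

/-!
# `ConnectedThreePoint` bound, quadratic vertices (U5-BLOCKERS §2, lift L2):
# `|κ₃⁰(linCurvSq p, linCurvSq q, quadVal M)| ≤ β⁻³ · C·C_M·(1+log H)⁵ / (1 + ‖p − q‖₁)⁴`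

Width seat `ym-line-sfw-p2-w3` (g41), cell ym-idea-1; U5 prep, helper-grade.  Composition BY NAME of
✓`gaussCum3_quadVal` (exact Wick value `β⁻³·Σ A B M GGG`, ✓`…QuadFormCum3Chart`), ✓`ColourDiag.abs_triangle_le` (one dipole line × two gradient lines through
the vertex kernel, ✓`…ColourDiagContraction`), the line's kernel decays ✓U1c `landauDipoleDecay` (`|Λ_p·GΛ_q| ≤ C(1+log H)/(1+‖p−q‖₁)⁴`) and ✓H4b.1′
`landauKernelGradDecay` (`|(GΛ_p)_e| ≤ C(1+log H)/(1+‖e−p‖₁)³`), and the edge two-centre sums ✓`EdgeSums.edgeTwoCentreSums` ((2,4) then (2,2)):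

* `linCurvSq_eq_quadVal` — the Gaussian part of the plaquette cost is the colour-diagonal rank-one form of `landauCoeff H p`:
  `linCurvSq H p a = quadVal (of fun i j => [i.2 = j.2]·Λ_p i.1·Λ_p j.1) a`;
* ★★ `abs_gaussCum3_linCurvSq_linCurvSq_quadVal_le` — for `H ≥ 1`, `β > 0`, `C_M ≥ 0`, a symmetric `M` with `|M i j| ≤ C_M/(1+d_∞(base i, base j))⁴`
  and plaquettes `p q`:
  `|E₀[L_pL_qQ_M] − E₀[L_p]E₀[L_qQ_M] − E₀[L_q]E₀[L_pQ_M] − E₀[Q_M]E₀[L_pL_q] + 2E₀[L_p]E₀[L_q]E₀[Q_M]| ≤ β⁻³·C·C_M·(1+log H)⁵/(1+‖p−q‖₁)⁴`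
  (`E₀ = gaussAvg β H`, `L_p = linCurvSq H p`, `Q_M = quadVal M`).
RELATIVE to the main term `(3/4)·boxDirCircSqCov ≍ T⁻⁸` of ASSEMBLY-S5 (e3) this is `T⁴·polylog/β ≤ H⁴·polylog/β → 0` iff `4θ < 1` — the L2 price of U5-BLOCKERS
§2 for the QUADRATIC even vertices (ghost `quadVal M_H` via ✓`GhostFP.abs_ghostM_le`; Haar `−Σ‖a_e‖²/12 = quadVal(−(1/12)·1)`, a diagonal kernel), replacing
the Cauchy–Schwarz `H¹²/β` of blocker B2.  Not here: the observables' quartic parts `c⁽⁴⁾`, the quartic vertices `W₄`/`Φ⁴`, the `1_D` truncation.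

Tree + Mathlib only; no definitions; standard axioms.  HONEST LABEL: a tool for the RECORDED lift L2 of the NEXT rung U5 (⟨stmt-QuantumFields-24336⟩, UNSTAFFED);
⟨24004⟩ ⟨24336⟩ remain OPEN; route AllWindowsColdBox is DRAFT; no crux, rung or summit is proved; **the Yang–Mills mass gap is NOT proved by this file; no
summit is proved by a line.**
-/

set_option autoImplicit false

noncomputable section

open Matrix Finset
open scoped Kronecker
open Literature.Probability.LatticeModels (Site)
open Literature.MathematicalPhysics.QuantumFieldTheory (Plaq)

namespace Summit.QuantumFields.YangMills.Theorems.AllWindowsColdBoxBoxHighLine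

namespace Cum3Triangle

variable {H : ℕ}

/-! ## The plaquette form -/

/-- `linCurvSq H p` is the quadratic form of the colour-diagonal rank-one matrix of `landauCoeff H p`. -/
theorem linCurvSq_eq_quadVal (p : Plaq 4) (a : LandauFree H → E3) :
    linCurvSq H p a =
      quadVal (Matrix.of fun i j : LandauFree H × Fin 3 => if i.2 = j.2 then landauCoeff H p i.1 * landauCoeff H p j.1 else 0) a := by
  rw [quadVal, linCurvSq]
  simp only [flat, linCurv, colour, dotProduct, Matrix.mulVec, Matrix.of_apply]
  rw [Fintype.sum_prod_type, Finset.sum_comm]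
  refine Finset.sum_congr rfl fun c _ => ?_
  have hinner : ∀ e : LandauFree H,
      (∑ j : LandauFree H × Fin 3, (if ((e, c) : LandauFree H × Fin 3).2 = j.2 then landauCoeff H p e * landauCoeff H p j.1 else 0) * a j.1 j.2) =
        ∑ e', landauCoeff H p e * landauCoeff H p e' * a e' c := by
    intro e
    rw [Fintype.sum_prod_type]
    refine Finset.sum_congr rfl fun e' _ => ?_
    simp only [ite_mul, zero_mul]
    rw [Finset.sum_ite_eq]
    simp
  simp only [hinner]
  rw [sq, Finset.sum_mul_sum]
  refine Finset.sum_congr rfl fun e _ => ?_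
  rw [Finset.mul_sum]
  exact Finset.sum_congr rfl fun e' _ => by ring

/-- The plaquette form is symmetric. -/
theorem plaqForm_isSymm (u : LandauFree H → ℝ) :
    (Matrix.of fun i j : LandauFree H × Fin 3 => if i.2 = j.2 then u i.1 * u j.1 else 0).IsSymm := by
  ext i j
  simp only [Matrix.transpose_apply, Matrix.of_apply]
  by_cases h : i.2 = j.2
  · rw [if_pos h, if_pos h.symm, mul_comm]
  · rw [if_neg h, if_neg (Ne.symm h)]

/-- `(hodgeQ H)⁻¹` is symmetric. -/
theorem hodgeQ_inv_apply_comm (e e' : LandauFree H) : (hodgeQ H)⁻¹ e e' = (hodgeQ H)⁻¹ e' e := by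
  have hT : (hodgeQ H)ᵀ = hodgeQ H := by
    have h := (hodgeQ_posDef H).isHermitian.eq
    rwa [Matrix.conjTranspose_eq_transpose_of_trivial] at h
  rw [← Matrix.transpose_apply (hodgeQ H)⁻¹ e' e, Matrix.transpose_nonsing_inv, hT]

/-- `w ᵥ* (hodgeQ H)⁻¹ = (hodgeQ H)⁻¹ *ᵥ w`. -/
theorem vecMul_hodgeQ_inv (w : LandauFree H → ℝ) (e : LandauFree H) : (w ᵥ* (hodgeQ H)⁻¹) e = ((hodgeQ H)⁻¹ *ᵥ w) e := by
  simp only [Matrix.vecMul, Matrix.mulVec, dotProduct]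
  exact Finset.sum_congr rfl fun i _ => by rw [hodgeQ_inv_apply_comm, mul_comm]

/-- `(1+d)⁻³ ≤ (1+d)⁻²` for `d ≥ 0`. -/
theorem one_div_pow_three_le_two {d : ℝ} (hd : 0 ≤ d) : 1 / (1 + d) ^ 3 ≤ 1 / (1 + d) ^ 2 :=
  one_div_le_one_div_of_le (by positivity) (pow_le_pow_right₀ (by linarith) (by norm_num))

/-! ## The bound -/

/-- ★★ **`ConnectedThreePoint` bound for quadratic vertices.**  `∃ C ≥ 0`: for `H ≥ 1`, `β > 0`, `C_M ≥ 0`, every symmetric `M` with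
`|M i j| ≤ C_M/(1+d_∞(base i, base j))⁴` and all plaquettes `p q`,
`|κ₃^{gaussAvg β H}(linCurvSq p, linCurvSq q, quadVal M)| ≤ β⁻³·C·C_M·(1+log H)⁵/(1 + ‖p−q‖₁)⁴`. -/
theorem abs_gaussCum3_linCurvSq_linCurvSq_quadVal_le : ∃ C : ℝ, 0 ≤ C ∧ ∀ H : ℕ, 1 ≤ H → ∀ β : ℝ, 0 < β →
    ∀ CM : ℝ, 0 ≤ CM → ∀ M : Matrix (LandauFree H × Fin 3) (LandauFree H × Fin 3) ℝ, M.IsSymm →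
    (∀ i j : LandauFree H × Fin 3, |M i j| ≤ CM / (1 + siteDist (i.1.1.1).1 (j.1.1.1).1) ^ 4) → ∀ p q : Plaq 4,
    |gaussAvg β H (fun a => linCurvSq H p a * linCurvSq H q a * quadVal M a) -
        gaussAvg β H (linCurvSq H p) * gaussAvg β H (fun a => linCurvSq H q a * quadVal M a) -
        gaussAvg β H (linCurvSq H q) * gaussAvg β H (fun a => linCurvSq H p a * quadVal M a) -
        gaussAvg β H (quadVal M) * gaussAvg β H (fun a => linCurvSq H p a * linCurvSq H q a) +
        2 * (gaussAvg β H (linCurvSq H p) * gaussAvg β H (linCurvSq H q) * gaussAvg β H (quadVal M))| ≤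
      β⁻¹ ^ 3 * (C * CM * (1 + Real.log H) ^ 5 / (1 + (((∑ m : Fin 4, |p.1 m - q.1 m|) : ℤ) : ℝ)) ^ 4) := by
  obtain ⟨CK₀, hK⟩ := RestBlock.landauDipoleDecay
  obtain ⟨CD₀, hD⟩ := RestBlock.landauKernelGradDecay
  obtain ⟨C₂, hC₂0, h2c⟩ := EdgeSums.edgeTwoCentreSums
  set CK : ℝ := max CK₀ 0 with hCKdef
  set CD : ℝ := max CD₀ 0 with hCDdef
  have hCK : 0 ≤ CK := le_max_right _ _
  have hCD : 0 ≤ CD := le_max_right _ _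
  refine ⟨3 * CK * CD ^ 2 * C₂ ^ 2, by positivity, fun H hH β hβ CM hCM M hM hMb p q => ?_⟩
  have hH' : (1 : ℝ) ≤ H := by exact_mod_cast hH
  set L : ℝ := 1 + Real.log H with hL
  have hL1 : 1 ≤ L := by have := Real.log_nonneg hH'; linarith
  have hL0 : 0 ≤ L := by linarith
  -- the objects
  set u : LandauFree H → ℝ := landauCoeff H p with hu
  set w : LandauFree H → ℝ := landauCoeff H q with hw
  set g : Matrix (LandauFree H) (LandauFree H) ℝ := (hodgeQ H)⁻¹ with hg
  set A : Matrix (LandauFree H × Fin 3) (LandauFree H × Fin 3) ℝ :=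
    Matrix.of fun i j => if i.2 = j.2 then u i.1 * u j.1 else 0 with hAdef
  set B : Matrix (LandauFree H × Fin 3) (LandauFree H × Fin 3) ℝ :=
    Matrix.of fun i j => if i.2 = j.2 then w i.1 * w j.1 else 0 with hBdef
  set G : Matrix (LandauFree H × Fin 3) (LandauFree H × Fin 3) ℝ := (hodgeQ H ⊗ₖ (1 : Matrix (Fin 3) (Fin 3) ℝ))⁻¹ with hGdef
  have hA : ∀ i j, A i j = if i.2 = j.2 then u i.1 * u j.1 else 0 := fun i j => rfl
  have hB : ∀ i j, B i j = if i.2 = j.2 then w i.1 * w j.1 else 0 := fun i j => rfl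
  have hG : ∀ i j, G i j = if i.2 = j.2 then g i.1 j.1 else 0 := fun i j =>
    EdgeChartGaussian.kronecker_one_inv_apply (hodgeQ H) (hodgeQ_posDef H).det_pos.ne' i j
  -- Step 1: the exact Wick value
  have hLp : (fun a => linCurvSq H p a) = quadVal A := funext fun a => linCurvSq_eq_quadVal p a
  have hLq : (fun a => linCurvSq H q a) = quadVal B := funext fun a => linCurvSq_eq_quadVal q a
  have hLp' : linCurvSq H p = quadVal A := hLp
  have hLq' : linCurvSq H q = quadVal B := hLq
  have hexact := gaussCum3_quadVal H hβ A B M (plaqForm_isSymm u) (plaqForm_isSymm w) hM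
  have hrew : gaussAvg β H (fun a => linCurvSq H p a * linCurvSq H q a * quadVal M a) -
        gaussAvg β H (linCurvSq H p) * gaussAvg β H (fun a => linCurvSq H q a * quadVal M a) -
        gaussAvg β H (linCurvSq H q) * gaussAvg β H (fun a => linCurvSq H p a * quadVal M a) -
        gaussAvg β H (quadVal M) * gaussAvg β H (fun a => linCurvSq H p a * linCurvSq H q a) +
        2 * (gaussAvg β H (linCurvSq H p) * gaussAvg β H (linCurvSq H q) * gaussAvg β H (quadVal M)) =
      β⁻¹ ^ 3 * ∑ a, ∑ a', ∑ b, ∑ b', ∑ c, ∑ c', A a a' * B b b' * M c c' * (G a' b * G b' c * G c' a) := by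
    rw [← hexact]
    simp only [hLp', hLq']
  rw [hrew, abs_mul, abs_of_pos (by positivity : (0 : ℝ) < β⁻¹ ^ 3)]
  refine mul_le_mul_of_nonneg_left ?_ (by positivity)
  -- Step 2: the kernel bounds
  have hBK : |u ⬝ᵥ (g *ᵥ w)| ≤ CK * L / (1 + (((∑ m : Fin 4, |p.1 m - q.1 m|) : ℤ) : ℝ)) ^ 4 := by
    refine (hK H hH p q).trans (div_le_div_of_nonneg_right (mul_le_mul_of_nonneg_right (le_max_left _ _) hL0) (by positivity))
  have hgrad : ∀ (r : Plaq 4) (e : LandauFree H), |(g *ᵥ landauCoeff H r) e| ≤ CD * L / (1 + siteDist e.1.1.1 r.1) ^ 2 := by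
    intro r e
    have h1 := hD H hH e r
    have hd0 := GhostKernel.siteDist_nonneg e.1.1.1 r.1
    calc |(g *ᵥ landauCoeff H r) e| ≤ CD₀ * L / (1 + (((∑ m : Fin 4, |e.1.1.1 m - r.1 m|) : ℤ) : ℝ)) ^ 3 := h1
      _ ≤ CD * L / (1 + (((∑ m : Fin 4, |e.1.1.1 m - r.1 m|) : ℤ) : ℝ)) ^ 3 :=
          div_le_div_of_nonneg_right (mul_le_mul_of_nonneg_right (le_max_left _ _) hL0) (by positivity)
      _ ≤ CD * L / (1 + siteDist e.1.1.1 r.1) ^ 3 := EdgeSums.div_l1_pow_le (by positivity) _ _ 3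
      _ = CD * L * (1 / (1 + siteDist e.1.1.1 r.1) ^ 3) := by ring
      _ ≤ CD * L * (1 / (1 + siteDist e.1.1.1 r.1) ^ 2) := mul_le_mul_of_nonneg_left (one_div_pow_three_le_two hd0) (by positivity)
      _ = CD * L / (1 + siteDist e.1.1.1 r.1) ^ 2 := by ring
  have hBu : ∀ e, |(g *ᵥ u) e| ≤ CD * L / (1 + siteDist e.1.1.1 p.1) ^ 2 := fun e => hgrad p e
  have hBw : ∀ e, |(w ᵥ* g) e| ≤ CD * L / (1 + siteDist e.1.1.1 q.1) ^ 2 := fun e => by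
    rw [vecMul_hodgeQ_inv]; exact hgrad q e
  have hBM : ∀ (e e' : LandauFree H) (κ : Fin 3), |M (e, κ) (e', κ)| ≤ CM / (1 + siteDist e.1.1.1 e'.1.1.1) ^ 4 :=
    fun e e' κ => hMb (e, κ) (e', κ)
  have main := ColourDiag.abs_triangle_le u w g M hA hB hG hBK hBw hBu hBM
  refine main.trans ?_
  -- Step 3: the lattice sums
  have hinner : ∀ e : LandauFree H, ∑ e' : LandauFree H, CD * L / (1 + siteDist e.1.1.1 q.1) ^ 2 *
      (CM / (1 + siteDist e.1.1.1 e'.1.1.1) ^ 4) * (CD * L / (1 + siteDist e'.1.1.1 p.1) ^ 2) ≤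
      CD * L / (1 + siteDist e.1.1.1 q.1) ^ 2 * (CM * CD * L * (C₂ * L / (1 + siteDist e.1.1.1 p.1) ^ 2)) := by
    intro e
    have h24 := (h2c H hH p.1 e.1.1.1).2.1
    have hfac : ∀ e' : LandauFree H, CD * L / (1 + siteDist e.1.1.1 q.1) ^ 2 * (CM / (1 + siteDist e.1.1.1 e'.1.1.1) ^ 4) *
        (CD * L / (1 + siteDist e'.1.1.1 p.1) ^ 2) =
        CD * L / (1 + siteDist e.1.1.1 q.1) ^ 2 * (CM * CD * L) *
          (1 / ((1 + siteDist e'.1.1.1 p.1) ^ 2 * (1 + siteDist e'.1.1.1 e.1.1.1) ^ 4)) := by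
      intro e'
      rw [EdgeChartGaussian.siteDist_comm e.1.1.1 e'.1.1.1]
      have h1 : (1 + siteDist e'.1.1.1 p.1) ^ 2 ≠ 0 := by have := GhostKernel.siteDist_nonneg e'.1.1.1 p.1; positivity
      have h2 : (1 + siteDist e'.1.1.1 e.1.1.1) ^ 4 ≠ 0 := by have := GhostKernel.siteDist_nonneg e'.1.1.1 e.1.1.1; positivity
      field_simp
    simp_rw [hfac]
    rw [← Finset.mul_sum]
    have hXY : 0 ≤ CD * L / (1 + siteDist e.1.1.1 q.1) ^ 2 * (CM * CD * L) := by
      have := GhostKernel.siteDist_nonneg e.1.1.1 q.1; positivity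
    calc CD * L / (1 + siteDist e.1.1.1 q.1) ^ 2 * (CM * CD * L) *
          ∑ e' : LandauFree H, 1 / ((1 + siteDist e'.1.1.1 p.1) ^ 2 * (1 + siteDist e'.1.1.1 e.1.1.1) ^ 4)
        ≤ CD * L / (1 + siteDist e.1.1.1 q.1) ^ 2 * (CM * CD * L) * (C₂ * (1 + Real.log H) / (1 + siteDist p.1 e.1.1.1) ^ 2) :=
          mul_le_mul_of_nonneg_left h24 hXY
      _ = CD * L / (1 + siteDist e.1.1.1 q.1) ^ 2 * (CM * CD * L * (C₂ * L / (1 + siteDist e.1.1.1 p.1) ^ 2)) := by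
          rw [hL, EdgeChartGaussian.siteDist_comm p.1 e.1.1.1]; ring
  have houter : ∑ e : LandauFree H, CD * L / (1 + siteDist e.1.1.1 q.1) ^ 2 * (CM * CD * L * (C₂ * L / (1 + siteDist e.1.1.1 p.1) ^ 2)) ≤
      CM * CD ^ 2 * C₂ * L ^ 3 * (C₂ * L) := by
    have h22 := (h2c H hH q.1 p.1).1
    have hfac : ∀ e : LandauFree H, CD * L / (1 + siteDist e.1.1.1 q.1) ^ 2 * (CM * CD * L * (C₂ * L / (1 + siteDist e.1.1.1 p.1) ^ 2)) =
        CM * CD ^ 2 * C₂ * L ^ 3 * (1 / ((1 + siteDist e.1.1.1 q.1) ^ 2 * (1 + siteDist e.1.1.1 p.1) ^ 2)) := by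
      intro e
      have h1 : (1 + siteDist e.1.1.1 q.1) ^ 2 ≠ 0 := by have := GhostKernel.siteDist_nonneg e.1.1.1 q.1; positivity
      have h2 : (1 + siteDist e.1.1.1 p.1) ^ 2 ≠ 0 := by have := GhostKernel.siteDist_nonneg e.1.1.1 p.1; positivity
      field_simp
    simp_rw [hfac]
    rw [← Finset.mul_sum]
    refine mul_le_mul_of_nonneg_left ?_ (by positivity)
    rw [hL]; exact h22
  calc CK * L / (1 + (((∑ m : Fin 4, |p.1 m - q.1 m|) : ℤ) : ℝ)) ^ 4 *
        ∑ κ : Fin 3, ∑ e : LandauFree H, ∑ e' : LandauFree H, CD * L / (1 + siteDist e.1.1.1 q.1) ^ 2 *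
          (CM / (1 + siteDist e.1.1.1 e'.1.1.1) ^ 4) * (CD * L / (1 + siteDist e'.1.1.1 p.1) ^ 2)
      ≤ CK * L / (1 + (((∑ m : Fin 4, |p.1 m - q.1 m|) : ℤ) : ℝ)) ^ 4 * ∑ _κ : Fin 3, CM * CD ^ 2 * C₂ * L ^ 3 * (C₂ * L) := by
        refine mul_le_mul_of_nonneg_left (Finset.sum_le_sum fun κ _ => ?_) (by positivity)
        exact (Finset.sum_le_sum fun e _ => hinner e).trans houter
    _ = 3 * CK * CD ^ 2 * C₂ ^ 2 * CM * (1 + Real.log H) ^ 5 / (1 + (((∑ m : Fin 4, |p.1 m - q.1 m|) : ℤ) : ℝ)) ^ 4 := by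
        rw [Finset.sum_const, Finset.card_univ, Fintype.card_fin, nsmul_eq_mul, hL]
        push_cast
        ring

end Cum3Triangle

end Summit.QuantumFields.YangMills.Theorems.AllWindowsColdBoxBoxHighLine

end
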